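import Literature.NumberTheory.DiophantineApproximation.RhinViolaDoubleResidue
import Mathlib.Algebra.Polynomial.Degree.SmallDegree
import HarnessLib

/-!
# The linear decomposition (2.29) for Rhin–Viola's double contour integral `I_z^{(2)}`

Topic `Literature/NumberTheory/DiophantineApproximation`. Everything here is PROVED (no definitions, no named
facts). Source: G. Rhin, C. Viola, *The permutation group method for the dilogarithm*, Ann. Sc. Norm. Super.
Pisa (5) 4 (2005) 389–437, (2.28)–(2.29): from `y^{k+1}(1−y)^l (x(1−y)+yz) / (x(1−y)+yz)^{j+k−m+2}` one gets, for
all three members `ν = 0, 1, 2` and with the normalisation `z^{−l−m}`,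

  `I_z^{(ν)}(h, j, k+1, l, m+1) = z^{−1} I_z^{(ν)}(h, j, k, l, m) − I_z^{(ν)}(h, j, k, l+1, m)`   (2.29).

For `ν = 0, 1` this is `I0_succ_k_succ_m`, `I1_succ_k_succ_m` (`RhinViolaIntegrals`, `RhinViolaResidueForm`).
Here we prove it for the double residue `RhinViola.I2` (`RhinViolaDoubleResidue.lean`): all three terms have the
same pole order `n = j+k−m+1` and the same outer factor `X^j(1−X)^h`, and the inner polynomials satisfy
`D^{(n−1)}(Y^{k+1}(1−Y)^l) = D^{(n−1)}(Y^k(1−Y)^l) − D^{(n−1)}(Y^k(1−Y)^{l+1})`, so (2.29) is linearity of the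
residue formula in the inner polynomial (plus the vanishing of the coefficient of index `k+l+1` of `Q = P∘(1+zW)`,
`deg Q ≤ k+l`).

## References

* G. Rhin, C. Viola, Ann. Sc. Norm. Super. Pisa Cl. Sci. (5) 4 (2005) 389–437, (2.29). [RhinViola2005]
-/

noncomputable section

namespace Literature.NumberTheory.DiophantineApproximation

namespace RhinViola

open Finset Polynomial

/-- `deg (D^{(r)}(Y^k(1−Y)^l) ∘ (1 + zW)) ≤ k + l`. [folklore] -/
theorem natDegree_hasseDeriv_comp_le (z : ℝ) (r k l : ℕ) :
    ((hasseDeriv r ((X : ℝ[X]) ^ k * (1 - X) ^ l)).comp (1 + C z * X)).natDegree ≤ k + l := by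
  have h1 : ((X : ℝ[X]) ^ k * (1 - X) ^ l).natDegree ≤ k + l := by
    refine natDegree_mul_le.trans (Nat.add_le_add (natDegree_pow_le.trans ?_) (natDegree_pow_le.trans ?_))
    · simp
    · refine (Nat.mul_le_mul_left l ((natDegree_sub_le _ _).trans ?_)).trans (le_of_eq (mul_one l))
      simp
  have h2 : (hasseDeriv r ((X : ℝ[X]) ^ k * (1 - X) ^ l)).natDegree ≤ k + l :=
    (natDegree_hasseDeriv_le _ _).trans ((Nat.sub_le _ _).trans h1)
  have h3 : ((1 : ℝ[X]) + C z * X).natDegree ≤ 1 := by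
    rw [add_comm, ← C_1]
    exact natDegree_linear_le
  refine natDegree_comp_le.trans ?_
  calc (hasseDeriv r ((X : ℝ[X]) ^ k * (1 - X) ^ l)).natDegree * ((1 : ℝ[X]) + C z * X).natDegree
      ≤ (k + l) * 1 := Nat.mul_le_mul h2 h3
    _ = k + l := mul_one _

/-- **Rhin–Viola (2.29) for `I_z^{(2)}`**: `I2 z h j (k+1) l (m+1) = z⁻¹ · I2 z h j k l m − I2 z h j k (l+1) m`
(`z ≠ 0`). [cite: RhinViola2005, (2.29)] -/
theorem I2_succ_k_succ_m {z : ℝ} (hz : z ≠ 0) (h j k l m : ℕ) :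
    I2 z h j (k + 1) l (m + 1) = z⁻¹ * I2 z h j k l m - I2 z h j k (l + 1) m := by
  by_cases hm : m ≤ j + k
  · unfold I2
    rw [if_pos (by omega), if_pos hm, if_pos hm, show j + (k + 1) - (m + 1) = j + k - m by omega]
    set n1 := j + k - m with hn1
    set F : ℝ[X] := X ^ j * (1 - X) ^ h with hF
    set Q1 : ℝ[X] := (hasseDeriv n1 ((X : ℝ[X]) ^ k * (1 - X) ^ l)).comp (1 + C z * X) with hQ1
    set Q2 : ℝ[X] := (hasseDeriv n1 ((X : ℝ[X]) ^ k * (1 - X) ^ (l + 1))).comp (1 + C z * X) with hQ2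
    -- the inner polynomials: `D^{(n−1)}(Y^{k+1}(1−Y)^l) ∘ (1+zW) = Q1 − Q2`
    have hpoly : ((X : ℝ[X]) ^ (k + 1) * (1 - X) ^ l) = X ^ k * (1 - X) ^ l - X ^ k * (1 - X) ^ (l + 1) := by
      ring
    have hQ : (hasseDeriv n1 ((X : ℝ[X]) ^ (k + 1) * (1 - X) ^ l)).comp (1 + C z * X) = Q1 - Q2 := by
      rw [hpoly, map_sub, sub_comp]
    -- the top coefficient of `Q1` vanishes
    have htop : Q1.coeff (k + l + 1) = 0 :=
      coeff_eq_zero_of_natDegree_lt (Nat.lt_succ_of_le (natDegree_hasseDeriv_comp_le z n1 k l))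
    have hsum1 : ∑ i ∈ range (k + 1 + l + 1), (Q1 - Q2).coeff i * (hasseDeriv (i + n1) F).eval z =
        (∑ i ∈ range (k + l + 1), Q1.coeff i * (hasseDeriv (i + n1) F).eval z) -
          ∑ i ∈ range (k + (l + 1) + 1), Q2.coeff i * (hasseDeriv (i + n1) F).eval z := by
      rw [show k + 1 + l + 1 = k + l + 1 + 1 by ring, show k + (l + 1) + 1 = k + l + 1 + 1 by ring]
      simp only [coeff_sub, sub_mul, sum_sub_distrib]
      rw [sum_range_succ (fun i => Q1.coeff i * (hasseDeriv (i + n1) F).eval z) (k + l + 1), htop, zero_mul,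
        add_zero]
    rw [hQ, hsum1]
    -- the powers of `z`
    have e1 : z ^ (-((l : ℤ) + ((m + 1 : ℕ) : ℤ))) = z⁻¹ * z ^ (-((l : ℤ) + m)) := by
      rw [show (-((l : ℤ) + ((m + 1 : ℕ) : ℤ))) = -((l : ℤ) + m) - 1 by push_cast; ring, zpow_sub_one₀ hz]
      ring
    have e2 : z ^ (-(((l + 1 : ℕ) : ℤ) + m)) = z⁻¹ * z ^ (-((l : ℤ) + m)) := by
      rw [show (-(((l + 1 : ℕ) : ℤ) + m)) = -((l : ℤ) + m) - 1 by push_cast; ring, zpow_sub_one₀ hz]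
      ring
    rw [e1, e2]
    ring
  · rw [I2_of_lt h (by omega : j + (k + 1) < m + 1), I2_of_lt h (by omega : j + k < m),
      I2_of_lt h (by omega : j + k < m)]
    ring

end RhinViola

end Literature.NumberTheory.DiophantineApproximation

end
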